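import Summits.Ventures.QEC.Census.BB.A1s_n162_k12_a0a80268
import Summits.Ventures.QEC.Census.BB.BBRows
import Summits.Ventures.QEC.Census.BB.Claims
import Literature.InformationTheory.QuantumCodes.TwoBlockConnectedComponents
import Literature.InformationTheory.QuantumCodes.TwoBlockToricLayout
import Literature.InformationTheory.QuantumCodes.TwoBlockWheelComponents
import Literature.InformationTheory.QuantumCodes.TwoBlockRootParameters
import HarnessLib
import HarnessLib.Audit.Tags

/-!
# Census rows as TYPED two-block codes `QC(A, B)` on `ℤ_ℓ × ℤ_m` — bridge batch `BridgeBatch6QC05` (1 row(s), kernel tier)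

Family: abelian two-block over ℤ_ℓ × ℤ_m (qec census one-module KERNEL-std rows: qec-search-7 certificate modules, MITM and
Brouwer–Zimmermann/automorphism formats). For each census row below (an EXPLICIT matrix code
`cert.code _ = CSSCode.ofMatrices (rowMatrix n cert.HX) (rowMatrix n cert.HZ)` with `IsCode n k d` certified in its own module), this file
puts the row's CONSTRUCTION into the kernel statement, as in the pilot `Census/BB/A1s_n144_k32_4addf704QC.lean` (p511732) and the
gen-4 batches `A1sRowsQC1–5` / `TwoBGARowsQC1–4`: monomial lists `la`, `lb` (from the certificate's construction record — the
docstring's `A_terms`/`B_terms` or the census row id `2bga-lℓmm-A…-B…`, monomials `xⁱyʲ` as `[i,j]`, convention of BCGMRY24 §4 =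
`BivariateBicycleCodes.lean`; the index identity was ALSO re-verified row-for-row by the emitter before filing), the typed object
`qc : BB.Code ℓ m := ⟨polyL la, polyL lb⟩`, the kernel INDEX IDENTITIES `cert.HX = BBRows.rowsX la lb`, `cert.HZ = BBRows.rowsZ la lb`
(`decide`; verified row generator `Census/BB/BBRows.lean`, p502918), the flat identities via `BBRows.rowMatrix_rowsX/Z`, the transport of
the row's own `dZ_eq` and `k` (its `k_eq`, or the `k`-component of its `isCode`) by type-05's `BB.Code.dZ_eq_of_flat` / `k_eq_of_flat` to
`qc_hasParams : BB.HasParams qc n k d` (census predicate of family BB, `Census/BB/Claims.lean`, distance EXACT) and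
`qc_isCode : qc.css.IsCode n k d`; and the census LAYOUT columns (Bravyi et al. 2024 §4 — arXiv:2308.07915: Lemma 2 p0010 L49, Lemma 3 p0011 L9, Lemma 4 p0011 L28; locators per qec-ref-2 2026-08-27T10:27Z) as KERNEL verdicts: «connected» —
`qc_tannerGraph_connected` (Lemma 3, `BB.Code.tannerGraph_connected_of_unit_mem`, explicit multiples of exponent differences) or
`qc_tannerGraph_not_connected` + `card_expDiffSubgroup` + `qc_card_connectedComponent` (`⟨S⟩` = an explicit finite carrier `diffList`,
both inclusions certified; exact component count by Lemma 3 (ii), `BB.Code.card_connectedComponent_mul_card`; by the tree's connected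
normal form `TwoBlockConnectedComponents.lean` such a code is the disjoint union of that many copies of its root code, whose parameters
`[[n/c, k/c, d]]` and connectedness are certified here as `root_isCode` via `TwoBlockRootParameters.lean`); «toric layout» —
`qc_hasToricLayoutWith μ λ` (Lemma 4, `BB.Code.hasToricLayoutWith_of_exponents`; omitted when its sufficient condition has no witness);
«wheel layers» — `qc_wheel_layers` (Lemma 2 minus planarity, `BB.Code.exists_wheel_layers`, weight-(3,3) rows only):

* `A1s_n162_k12_a0a80268` = `QC(1 + y^3 + x, y^18 + y^24 + x^2)` on `ℤ_3 × ℤ_27`: `[[162, 12, 8]]`; Tanner graph NOT connected: |⟨S⟩| = 27, 3 components (= 3 × [[54, 4, 8]] — root code KERNEL `root_isCode`); wheel layers 18/18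

No new certificate — tier KERNEL, axioms standard, no `native_decide`. HONEST FRAMING: identifies already-certified census objects with
named algebraic constructions and decides structural (graph) properties; the census comparator columns (printed values, optimality
words) are not touched; for disconnected rows the root code is identified abstractly over `↥⟨S⟩` (not re-indexed to a named `QC(A',B')`,
not identified with a smaller census row); planarity/thickness is not asserted. Generated by
qec-type-05 gen 6's `tools/emit_qc_bridge3.py` (gen 5's emitter + sibling-data rows + ℓ = 1 connectivity) + `tools/conn_cert.py` (HOME/lean/type-05/tools/).
-/

namespace Summit.Ventures.QEC.Census.A1s_n162_k12_a0a80268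

open Matrix Literature.InformationTheory.QuantumCodes BBRows

/-- Monomials of `A = 1 + y^3 + x` (construction `A_terms = [[0, 0], [0, 3], [1, 0]]`, from the census generator file `census/search-3/gens/a1/A1s_n162_k12_a0a80268.json` (matrix_sha256 `a0a80268b9c7e440…`; `A = 1+y^3+x`, `B = y^18+y^24+x^2`)). DATA. -/
def la : List (BB.Mono 3 27) := [(Fin.ofNat 3 0, Fin.ofNat 27 0), (Fin.ofNat 3 0, Fin.ofNat 27 3), (Fin.ofNat 3 1, Fin.ofNat 27 0)]

/-- Monomials of `B = y^18 + y^24 + x^2` (construction `B_terms = [[0, 18], [0, 24], [2, 0]]`). DATA. -/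
def lb : List (BB.Mono 3 27) := [(Fin.ofNat 3 0, Fin.ofNat 27 18), (Fin.ofNat 3 0, Fin.ofNat 27 24), (Fin.ofNat 3 2, Fin.ofNat 27 0)]

/-- The census row's code as a TYPED two-block code `QC(1 + y^3 + x, y^18 + y^24 + x^2)` on `ℤ_3 × ℤ_27` (`BB.Code 3 27`). (definition) -/
def qc : BB.Code 3 27 := ⟨polyL la, polyL lb⟩

set_option maxRecDepth 100000 in
/-- INDEX IDENTITY, `X` side, in the kernel: the certificate's `H^X` rows ARE the `X`-check words of `qc` (`decide +kernel`). -/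
theorem HX_eq_rowsX : A1s_n162_k12_a0a80268.cert.HX = rowsX la lb := by
  decide +kernel

set_option maxRecDepth 100000 in
/-- INDEX IDENTITY, `Z` side. -/
theorem HZ_eq_rowsZ : A1s_n162_k12_a0a80268.cert.HZ = rowsZ la lb := by
  decide +kernel

set_option maxRecDepth 100000 in
/-- The certificate's flat `H^X` is `qc.HXFlat`. -/
theorem rowMatrix_HX_eq : rowMatrix 162 A1s_n162_k12_a0a80268.cert.HX = qc.HXFlat := by
  have cast : ∀ {H H' : List ℕ} (e : H = H'),
      rowMatrix 162 H = (rowMatrix 162 H').submatrix (Fin.cast (congrArg List.length e)) id := by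
    intro H H' e; subst e; rfl
  exact (cast HX_eq_rowsX).trans (rowMatrix_rowsX qc (LA := la) (LB := lb) rfl rfl)

set_option maxRecDepth 100000 in
/-- The certificate's flat `H^Z` is `qc.HZFlat`. -/
theorem rowMatrix_HZ_eq : rowMatrix 162 A1s_n162_k12_a0a80268.cert.HZ = qc.HZFlat := by
  have cast : ∀ {H H' : List ℕ} (e : H = H'),
      rowMatrix 162 H = (rowMatrix 162 H').submatrix (Fin.cast (congrArg List.length e)) id := by
    intro H H' e; subst e; rfl
  exact (cast HZ_eq_rowsZ).trans (rowMatrix_rowsZ qc (LA := la) (LB := lb) rfl rfl)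

set_option maxRecDepth 100000 in
/-- `d^Z (qc) = 8`, transported from the census certificate (`A1s_n162_k12_a0a80268.dZ_eq`) by `BB.Code.dZ_eq_of_flat`. -/
theorem qc_dZ : qc.css.dZ = 8 :=
  (qc.dZ_eq_of_flat (D := A1s_n162_k12_a0a80268.cert.code (A1s_n162_k12_a0a80268.cert.commOK_of_checkStructure A1s_n162_k12_a0a80268.checkStructure_ok))
    rowMatrix_HX_eq rowMatrix_HZ_eq).symm.trans A1s_n162_k12_a0a80268.dZ_eq

set_option maxRecDepth 100000 in
/-- `k (qc) = 12`, transported from the census certificate (the `k`-component of `A1s_n162_k12_a0a80268.isCode`) by `BB.Code.k_eq_of_flat`. -/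
theorem qc_k : qc.k = 12 :=
  (qc.k_eq_of_flat (D := A1s_n162_k12_a0a80268.cert.code (A1s_n162_k12_a0a80268.cert.commOK_of_checkStructure A1s_n162_k12_a0a80268.checkStructure_ok))
    rowMatrix_HX_eq rowMatrix_HZ_eq).symm.trans A1s_n162_k12_a0a80268.isCode.2.1

/-- **`QC(1 + y^3 + x, y^18 + y^24 + x^2)` on `ℤ_3 × ℤ_27` has parameters `[[162, 12, 8]]`** (distance exact; `BB.HasParams`) — the census row
`A1s_n162_k12_a0a80268` read as a statement about the construction. KERNEL. -/
theorem qc_hasParams : Summit.Ventures.QEC.BB.HasParams qc 162 12 8 :=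
  BB.hasParams_of_dZ (by simp only [BB.numQubits_eq]) qc_k qc_dZ

/-- The same in the generic census vocabulary: `qc.css.IsCode 162 12 8`. -/
theorem qc_isCode : qc.css.IsCode 162 12 8 :=
  (BB.hasParams_iff_isCode (by decide)).1 qc_hasParams

/-! ### Connectivity: this row is DISCONNECTED (`|⟨S⟩| = 27` of `ℓm = 81` ⇒ `3` components by Lemma 3 (ii)) -/

/-- The exponent-difference subgroup `⟨S⟩` of `qc` as an explicit finite carrier (27 elements, closed under `0, +, −` —
computed by tools/conn_cert.py, closure re-checked by `decide` below). DATA. -/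
def diffList : List (BB.Mono 3 27) := [((0 : Fin 3), (0 : Fin 27)), ((0 : Fin 3), (3 : Fin 27)), ((0 : Fin 3), (6 : Fin 27)), ((0 : Fin 3), (9 : Fin 27)), ((0 : Fin 3), (12 : Fin 27)), ((0 : Fin 3), (15 : Fin 27)), ((0 : Fin 3), (18 : Fin 27)), ((0 : Fin 3), (21 : Fin 27)), ((0 : Fin 3), (24 : Fin 27)), ((1 : Fin 3), (0 : Fin 27)), ((1 : Fin 3), (3 : Fin 27)), ((1 : Fin 3), (6 : Fin 27)), ((1 : Fin 3), (9 : Fin 27)), ((1 : Fin 3), (12 : Fin 27)), ((1 : Fin 3), (15 : Fin 27)), ((1 : Fin 3), (18 : Fin 27)), ((1 : Fin 3), (21 : Fin 27)), ((1 : Fin 3), (24 : Fin 27)), ((2 : Fin 3), (0 : Fin 27)), ((2 : Fin 3), (3 : Fin 27)), ((2 : Fin 3), (6 : Fin 27)), ((2 : Fin 3), (9 : Fin 27)), ((2 : Fin 3), (12 : Fin 27)), ((2 : Fin 3), (15 : Fin 27)), ((2 : Fin 3), (18 : Fin 27)), ((2 : Fin 3), (21 : Fin 27)), ((2 : Fin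 3), (24 : Fin 27))]

set_option maxRecDepth 100000 in
/-- `diffList` contains `0`, is closed under addition and under negation (`decide`). -/
theorem diffList_closed : (((0 : Fin 3), (0 : Fin 27)) : BB.Mono 3 27) ∈ diffList ∧
    (∀ a b : BB.Mono 3 27, a ∈ diffList → b ∈ diffList → a + b ∈ diffList) ∧
    (∀ a : BB.Mono 3 27, a ∈ diffList → -a ∈ diffList) := by
  refine ⟨by decide +kernel, by decide +kernel, by decide +kernel⟩

/-- `⟨S⟩` as an additive subgroup with carrier `diffList`. (definition) -/
def diffSub : AddSubgroup (BB.Mono 3 27) where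
  carrier := {x | x ∈ diffList}
  zero_mem' := diffList_closed.1
  add_mem' := fun {a b} ha hb => diffList_closed.2.1 a b ha hb
  neg_mem' := fun {a} ha => diffList_closed.2.2 a ha

set_option maxRecDepth 100000 in
/-- Every exponent difference inside `A` and inside `B` lies in `diffList` (`decide` over all pairs of `ℤ_3 × ℤ_27`). -/
theorem diffs_mem : (∀ g g' : BB.Mono 3 27, qc.A g ≠ 0 → qc.A g' ≠ 0 → g - g' ∈ diffList) ∧
    (∀ g g' : BB.Mono 3 27, qc.B g ≠ 0 → qc.B g' ≠ 0 → g - g' ∈ diffList) := by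
  refine ⟨by decide +kernel, by decide +kernel⟩

/-- Hence `expDiffSubgroup qc ≤ diffSub`. -/
theorem expDiffSubgroup_le : qc.expDiffSubgroup ≤ diffSub :=
  (AddSubgroup.closure_le diffSub).2 (by
    rintro d (⟨g, g', hg, hg', rfl⟩ | ⟨g, g', hg, hg', rfl⟩)
    · exact diffs_mem.1 g g' hg hg'
    · exact diffs_mem.2 g g' hg hg')

set_option maxRecDepth 100000 in
/-- **The Tanner graph of `qc` is NOT connected** (Bravyi et al. 2024 Lemma 3: `⟨S⟩ ≠ ℤ_3 × ℤ_27` — the element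
`(0, 1)` is not an exponent-difference combination). Census column «connected» = false for this row, KERNEL. -/
theorem qc_tannerGraph_not_connected : ¬ qc.css.tannerGraph.Connected := fun h => by
  have htop := (qc.tannerGraph_connected_iff (fun h => absurd (congrFun h ((0 : Fin 3), (0 : Fin 27))) (by decide))
    (fun h => absurd (congrFun h ((0 : Fin 3), (18 : Fin 27))) (by decide))).1 h
  have hx : (((0 : Fin 3), (1 : Fin 27)) : BB.Mono 3 27) ∈ diffSub := expDiffSubgroup_le (htop ▸ AddSubgroup.mem_top _)
  have hx' : (((0 : Fin 3), (1 : Fin 27)) : BB.Mono 3 27) ∈ diffList := hx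
  exact absurd hx' (by decide)

set_option maxRecDepth 100000 in
/-- Conversely every element of `diffList` IS an exponent-difference combination (BFS certificate from `0`: each element = an
earlier one + one difference inside `A` or `B`; tools/conn_cert.py), so `⟨S⟩ = diffSub` exactly. -/
theorem diffList_le : ∀ x : BB.Mono 3 27, x ∈ diffList → x ∈ qc.expDiffSubgroup := by
  have m0 : (((0 : Fin 3), (0 : Fin 27)) : BB.Mono 3 27) ∈ qc.expDiffSubgroup := qc.expDiffSubgroup.zero_mem
  have m1 : (((0 : Fin 3), (24 : Fin 27)) : BB.Mono 3 27) ∈ qc.expDiffSubgroup := by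
    have e : (((0 : Fin 3), (24 : Fin 27)) : BB.Mono 3 27) =
        ((0 : Fin 3), (0 : Fin 27)) + ((((0 : Fin 3), (0 : Fin 27))) - (0, 3)) := by decide
    rw [e]
    exact qc.expDiffSubgroup.add_mem m0 (qc.sub_mem_expDiffSubgroup_A (by decide) (by decide))
  have m2 : (((2 : Fin 3), (0 : Fin 27)) : BB.Mono 3 27) ∈ qc.expDiffSubgroup := by
    have e : (((2 : Fin 3), (0 : Fin 27)) : BB.Mono 3 27) =
        ((0 : Fin 3), (0 : Fin 27)) + ((((0 : Fin 3), (0 : Fin 27))) - (1, 0)) := by decide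
    rw [e]
    exact qc.expDiffSubgroup.add_mem m0 (qc.sub_mem_expDiffSubgroup_A (by decide) (by decide))
  have m3 : (((0 : Fin 3), (3 : Fin 27)) : BB.Mono 3 27) ∈ qc.expDiffSubgroup := by
    have e : (((0 : Fin 3), (3 : Fin 27)) : BB.Mono 3 27) =
        ((0 : Fin 3), (0 : Fin 27)) + ((((0 : Fin 3), (3 : Fin 27))) - (0, 0)) := by decide
    rw [e]
    exact qc.expDiffSubgroup.add_mem m0 (qc.sub_mem_expDiffSubgroup_A (by decide) (by decide))
  have m4 : (((2 : Fin 3), (3 : Fin 27)) : BB.Mono 3 27) ∈ qc.expDiffSubgroup := by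
    have e : (((2 : Fin 3), (3 : Fin 27)) : BB.Mono 3 27) =
        ((0 : Fin 3), (0 : Fin 27)) + ((((0 : Fin 3), (3 : Fin 27))) - (1, 0)) := by decide
    rw [e]
    exact qc.expDiffSubgroup.add_mem m0 (qc.sub_mem_expDiffSubgroup_A (by decide) (by decide))
  have m5 : (((1 : Fin 3), (0 : Fin 27)) : BB.Mono 3 27) ∈ qc.expDiffSubgroup := by
    have e : (((1 : Fin 3), (0 : Fin 27)) : BB.Mono 3 27) =
        ((0 : Fin 3), (0 : Fin 27)) + ((((1 : Fin 3), (0 : Fin 27))) - (0, 0)) := by decide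
    rw [e]
    exact qc.expDiffSubgroup.add_mem m0 (qc.sub_mem_expDiffSubgroup_A (by decide) (by decide))
  have m6 : (((1 : Fin 3), (24 : Fin 27)) : BB.Mono 3 27) ∈ qc.expDiffSubgroup := by
    have e : (((1 : Fin 3), (24 : Fin 27)) : BB.Mono 3 27) =
        ((0 : Fin 3), (0 : Fin 27)) + ((((1 : Fin 3), (0 : Fin 27))) - (0, 3)) := by decide
    rw [e]
    exact qc.expDiffSubgroup.add_mem m0 (qc.sub_mem_expDiffSubgroup_A (by decide) (by decide))
  have m7 : (((0 : Fin 3), (21 : Fin 27)) : BB.Mono 3 27) ∈ qc.expDiffSubgroup := by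
    have e : (((0 : Fin 3), (21 : Fin 27)) : BB.Mono 3 27) =
        ((0 : Fin 3), (0 : Fin 27)) + ((((0 : Fin 3), (18 : Fin 27))) - (0, 24)) := by decide
    rw [e]
    exact qc.expDiffSubgroup.add_mem m0 (qc.sub_mem_expDiffSubgroup_B (by decide) (by decide))
  have m8 : (((1 : Fin 3), (18 : Fin 27)) : BB.Mono 3 27) ∈ qc.expDiffSubgroup := by
    have e : (((1 : Fin 3), (18 : Fin 27)) : BB.Mono 3 27) =
        ((0 : Fin 3), (0 : Fin 27)) + ((((0 : Fin 3), (18 : Fin 27))) - (2, 0)) := by decide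
    rw [e]
    exact qc.expDiffSubgroup.add_mem m0 (qc.sub_mem_expDiffSubgroup_B (by decide) (by decide))
  have m9 : (((0 : Fin 3), (6 : Fin 27)) : BB.Mono 3 27) ∈ qc.expDiffSubgroup := by
    have e : (((0 : Fin 3), (6 : Fin 27)) : BB.Mono 3 27) =
        ((0 : Fin 3), (0 : Fin 27)) + ((((0 : Fin 3), (24 : Fin 27))) - (0, 18)) := by decide
    rw [e]
    exact qc.expDiffSubgroup.add_mem m0 (qc.sub_mem_expDiffSubgroup_B (by decide) (by decide))
  have m10 : (((2 : Fin 3), (9 : Fin 27)) : BB.Mono 3 27) ∈ qc.expDiffSubgroup := by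
    have e : (((2 : Fin 3), (9 : Fin 27)) : BB.Mono 3 27) =
        ((0 : Fin 3), (0 : Fin 27)) + ((((2 : Fin 3), (0 : Fin 27))) - (0, 18)) := by decide
    rw [e]
    exact qc.expDiffSubgroup.add_mem m0 (qc.sub_mem_expDiffSubgroup_B (by decide) (by decide))
  have m11 : (((2 : Fin 3), (24 : Fin 27)) : BB.Mono 3 27) ∈ qc.expDiffSubgroup := by
    have e : (((2 : Fin 3), (24 : Fin 27)) : BB.Mono 3 27) =
        ((0 : Fin 3), (24 : Fin 27)) + ((((0 : Fin 3), (0 : Fin 27))) - (1, 0)) := by decide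
    rw [e]
    exact qc.expDiffSubgroup.add_mem m1 (qc.sub_mem_expDiffSubgroup_A (by decide) (by decide))
  have m12 : (((1 : Fin 3), (21 : Fin 27)) : BB.Mono 3 27) ∈ qc.expDiffSubgroup := by
    have e : (((1 : Fin 3), (21 : Fin 27)) : BB.Mono 3 27) =
        ((0 : Fin 3), (24 : Fin 27)) + ((((1 : Fin 3), (0 : Fin 27))) - (0, 3)) := by decide
    rw [e]
    exact qc.expDiffSubgroup.add_mem m1 (qc.sub_mem_expDiffSubgroup_A (by decide) (by decide))
  have m13 : (((0 : Fin 3), (18 : Fin 27)) : BB.Mono 3 27) ∈ qc.expDiffSubgroup := by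
    have e : (((0 : Fin 3), (18 : Fin 27)) : BB.Mono 3 27) =
        ((0 : Fin 3), (24 : Fin 27)) + ((((0 : Fin 3), (18 : Fin 27))) - (0, 24)) := by decide
    rw [e]
    exact qc.expDiffSubgroup.add_mem m1 (qc.sub_mem_expDiffSubgroup_B (by decide) (by decide))
  have m14 : (((1 : Fin 3), (15 : Fin 27)) : BB.Mono 3 27) ∈ qc.expDiffSubgroup := by
    have e : (((1 : Fin 3), (15 : Fin 27)) : BB.Mono 3 27) =
        ((0 : Fin 3), (24 : Fin 27)) + ((((0 : Fin 3), (18 : Fin 27))) - (2, 0)) := by decide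
    rw [e]
    exact qc.expDiffSubgroup.add_mem m1 (qc.sub_mem_expDiffSubgroup_B (by decide) (by decide))
  have m15 : (((2 : Fin 3), (6 : Fin 27)) : BB.Mono 3 27) ∈ qc.expDiffSubgroup := by
    have e : (((2 : Fin 3), (6 : Fin 27)) : BB.Mono 3 27) =
        ((0 : Fin 3), (24 : Fin 27)) + ((((2 : Fin 3), (0 : Fin 27))) - (0, 18)) := by decide
    rw [e]
    exact qc.expDiffSubgroup.add_mem m1 (qc.sub_mem_expDiffSubgroup_B (by decide) (by decide))
  have m16 : (((1 : Fin 3), (3 : Fin 27)) : BB.Mono 3 27) ∈ qc.expDiffSubgroup := by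
    have e : (((1 : Fin 3), (3 : Fin 27)) : BB.Mono 3 27) =
        ((2 : Fin 3), (0 : Fin 27)) + ((((0 : Fin 3), (3 : Fin 27))) - (1, 0)) := by decide
    rw [e]
    exact qc.expDiffSubgroup.add_mem m2 (qc.sub_mem_expDiffSubgroup_A (by decide) (by decide))
  have m17 : (((2 : Fin 3), (21 : Fin 27)) : BB.Mono 3 27) ∈ qc.expDiffSubgroup := by
    have e : (((2 : Fin 3), (21 : Fin 27)) : BB.Mono 3 27) =
        ((2 : Fin 3), (0 : Fin 27)) + ((((0 : Fin 3), (18 : Fin 27))) - (0, 24)) := by decide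
    rw [e]
    exact qc.expDiffSubgroup.add_mem m2 (qc.sub_mem_expDiffSubgroup_B (by decide) (by decide))
  have m18 : (((1 : Fin 3), (9 : Fin 27)) : BB.Mono 3 27) ∈ qc.expDiffSubgroup := by
    have e : (((1 : Fin 3), (9 : Fin 27)) : BB.Mono 3 27) =
        ((2 : Fin 3), (0 : Fin 27)) + ((((2 : Fin 3), (0 : Fin 27))) - (0, 18)) := by decide
    rw [e]
    exact qc.expDiffSubgroup.add_mem m2 (qc.sub_mem_expDiffSubgroup_B (by decide) (by decide))
  have m19 : (((0 : Fin 3), (9 : Fin 27)) : BB.Mono 3 27) ∈ qc.expDiffSubgroup := by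
    have e : (((0 : Fin 3), (9 : Fin 27)) : BB.Mono 3 27) =
        ((0 : Fin 3), (3 : Fin 27)) + ((((0 : Fin 3), (24 : Fin 27))) - (0, 18)) := by decide
    rw [e]
    exact qc.expDiffSubgroup.add_mem m3 (qc.sub_mem_expDiffSubgroup_B (by decide) (by decide))
  have m20 : (((2 : Fin 3), (12 : Fin 27)) : BB.Mono 3 27) ∈ qc.expDiffSubgroup := by
    have e : (((2 : Fin 3), (12 : Fin 27)) : BB.Mono 3 27) =
        ((0 : Fin 3), (3 : Fin 27)) + ((((2 : Fin 3), (0 : Fin 27))) - (0, 18)) := by decide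
    rw [e]
    exact qc.expDiffSubgroup.add_mem m3 (qc.sub_mem_expDiffSubgroup_B (by decide) (by decide))
  have m21 : (((1 : Fin 3), (6 : Fin 27)) : BB.Mono 3 27) ∈ qc.expDiffSubgroup := by
    have e : (((1 : Fin 3), (6 : Fin 27)) : BB.Mono 3 27) =
        ((2 : Fin 3), (3 : Fin 27)) + ((((0 : Fin 3), (3 : Fin 27))) - (1, 0)) := by decide
    rw [e]
    exact qc.expDiffSubgroup.add_mem m4 (qc.sub_mem_expDiffSubgroup_A (by decide) (by decide))
  have m22 : (((1 : Fin 3), (12 : Fin 27)) : BB.Mono 3 27) ∈ qc.expDiffSubgroup := by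
    have e : (((1 : Fin 3), (12 : Fin 27)) : BB.Mono 3 27) =
        ((2 : Fin 3), (3 : Fin 27)) + ((((2 : Fin 3), (0 : Fin 27))) - (0, 18)) := by decide
    rw [e]
    exact qc.expDiffSubgroup.add_mem m4 (qc.sub_mem_expDiffSubgroup_B (by decide) (by decide))
  have m23 : (((2 : Fin 3), (18 : Fin 27)) : BB.Mono 3 27) ∈ qc.expDiffSubgroup := by
    have e : (((2 : Fin 3), (18 : Fin 27)) : BB.Mono 3 27) =
        ((1 : Fin 3), (0 : Fin 27)) + ((((0 : Fin 3), (18 : Fin 27))) - (2, 0)) := by decide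
    rw [e]
    exact qc.expDiffSubgroup.add_mem m5 (qc.sub_mem_expDiffSubgroup_B (by decide) (by decide))
  have m24 : (((2 : Fin 3), (15 : Fin 27)) : BB.Mono 3 27) ∈ qc.expDiffSubgroup := by
    have e : (((2 : Fin 3), (15 : Fin 27)) : BB.Mono 3 27) =
        ((1 : Fin 3), (24 : Fin 27)) + ((((0 : Fin 3), (18 : Fin 27))) - (2, 0)) := by decide
    rw [e]
    exact qc.expDiffSubgroup.add_mem m6 (qc.sub_mem_expDiffSubgroup_B (by decide) (by decide))
  have m25 : (((0 : Fin 3), (15 : Fin 27)) : BB.Mono 3 27) ∈ qc.expDiffSubgroup := by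
    have e : (((0 : Fin 3), (15 : Fin 27)) : BB.Mono 3 27) =
        ((0 : Fin 3), (21 : Fin 27)) + ((((0 : Fin 3), (18 : Fin 27))) - (0, 24)) := by decide
    rw [e]
    exact qc.expDiffSubgroup.add_mem m7 (qc.sub_mem_expDiffSubgroup_B (by decide) (by decide))
  have m26 : (((0 : Fin 3), (12 : Fin 27)) : BB.Mono 3 27) ∈ qc.expDiffSubgroup := by
    have e : (((0 : Fin 3), (12 : Fin 27)) : BB.Mono 3 27) =
        ((0 : Fin 3), (6 : Fin 27)) + ((((0 : Fin 3), (24 : Fin 27))) - (0, 18)) := by decide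
    rw [e]
    exact qc.expDiffSubgroup.add_mem m9 (qc.sub_mem_expDiffSubgroup_B (by decide) (by decide))
  simp only [diffList, List.forall_mem_cons]
  exact ⟨m0, m3, m9, m19, m26, m25, m13, m7, m1, m5, m16, m21, m18, m22, m14, m8, m12, m6, m2, m4, m15, m10, m20, m24, m23, m17, m11, by simp⟩

/-- `⟨S⟩ = diffSub` (`27` elements). -/
theorem expDiffSubgroup_eq : qc.expDiffSubgroup = diffSub :=
  le_antisymm expDiffSubgroup_le (fun x hx => diffList_le x hx)

set_option maxRecDepth 100000 in
/-- `|⟨S⟩| = 27`. -/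
theorem card_expDiffSubgroup : Nat.card qc.expDiffSubgroup = 27 := by
  rw [expDiffSubgroup_eq]
  change Nat.card {x : BB.Mono 3 27 // x ∈ diffList} = 27
  rw [Nat.card_eq_fintype_card]
  decide +kernel

set_option maxRecDepth 100000 in
/-- **The Tanner graph of `qc` has exactly `3` connected components** (BCGMRY24 Lemma 3 (ii): `#components · |⟨S⟩| = ℓm`,
`81 / 27 = 3`); with the tree's connected normal form (`TwoBlockConnectedComponents.lean`) the code is the disjoint union of
`3` copies of the root two-block code over `⟨S⟩` — numerically `3 × [[54, 4, 8]]`. KERNEL. -/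
theorem qc_card_connectedComponent : Nat.card qc.css.tannerGraph.ConnectedComponent = 3 := by
  have h := qc.card_connectedComponent_mul_card
    (fun h => absurd (congrFun h ((0 : Fin 3), (0 : Fin 27))) (by decide))
    (fun h => absurd (congrFun h ((0 : Fin 3), (18 : Fin 27))) (by decide))
  rw [card_expDiffSubgroup] at h
  omega

open scoped Classical in
/-- **`= 3 ×` a CONNECTED root code `[[54, 4, 8]]`, KERNEL** (not only numerically): the typed root two-block code of `qc`
over `⟨S⟩` (`BB.Code.rootCode`, `Literature/InformationTheory/QuantumCodes/TwoBlockRootParameters.lean`, base exponents the first monomials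
of `A` and `B`) is a `[[54, 4, 8]]` code with a connected Tanner graph, and `3 ∣ 162`, `3 ∣ 12` (`BB.Code.rootCode_isCode` on
`qc_isCode` and `qc_card_connectedComponent`). The root is NOT re-indexed to a named `QC(A', B')` here. -/
theorem root_isCode :
    (qc.rootCode (((0 : Fin 3), (0 : Fin 27)) : BB.Mono 3 27) ((0 : Fin 3), (18 : Fin 27))).IsCode 54 4 8 ∧
    (qc.rootCode (((0 : Fin 3), (0 : Fin 27)) : BB.Mono 3 27) ((0 : Fin 3), (18 : Fin 27))).tannerGraph.Connected ∧ 3 ∣ 162 ∧ 3 ∣ 12 :=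
  qc.rootCode_isCode (by decide) (by decide) qc_isCode qc_card_connectedComponent

set_option maxRecDepth 100000 in
/-- **`qc`**: Tanner graph = edge-disjoint union of two layers whose components are wheel graphs `prismGraph 18` (`A₃A₂ᵀ` of order
`9`) and `prismGraph 18` (`B₂B₁ᵀ` of order `9`) — BCGMRY24 Lemma 2 minus planarity (`BB.Code.exists_wheel_layers`). KERNEL. -/
theorem qc_wheel_layers :
    ∃ ΓA ΓB : SimpleGraph ((BB.Mono 3 27 ⊕ BB.Mono 3 27) ⊕ (BB.Mono 3 27 ⊕ BB.Mono 3 27)),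
    qc.css.tannerGraph = ΓA ⊔ ΓB ∧ Disjoint ΓA ΓB ∧
    (∀ K : ΓA.ConnectedComponent, Nonempty (K.toSimpleGraph ≃g prismGraph 18)) ∧
    (∀ K : ΓB.ConnectedComponent, Nonempty (K.toSimpleGraph ≃g prismGraph 18)) := by
  have hA : ∀ g : BB.Mono 3 27, qc.A g ≠ 0 ↔ g = ((0 : Fin 3), (0 : Fin 27)) ∨ g = ((0 : Fin 3), (3 : Fin 27)) ∨ g = ((1 : Fin 3), (0 : Fin 27)) := by decide +kernel
  have hB : ∀ g : BB.Mono 3 27, qc.B g ≠ 0 ↔ g = ((0 : Fin 3), (18 : Fin 27)) ∨ g = ((0 : Fin 3), (24 : Fin 27)) ∨ g = ((2 : Fin 3), (0 : Fin 27)) := by decide +kernel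
  have h := qc.exists_wheel_layers (g₁ := ((0 : Fin 3), (0 : Fin 27))) (g₂ := ((0 : Fin 3), (3 : Fin 27))) (g₃ := ((1 : Fin 3), (0 : Fin 27))) (h₁ := ((0 : Fin 3), (18 : Fin 27)))
    (h₂ := ((0 : Fin 3), (24 : Fin 27))) (h₃ := ((2 : Fin 3), (0 : Fin 27))) (by decide) (by decide) (by decide) (by decide) (by decide) (by decide) hA hB
  have e1 : addOrderOf (((1 : Fin 3), (0 : Fin 27)) - (0, 3)) = 9 := (addOrderOf_eq_iff (by norm_num)).mpr (by decide)
  have e2 : addOrderOf (((0 : Fin 3), (24 : Fin 27)) - (0, 18)) = 9 := (addOrderOf_eq_iff (by norm_num)).mpr (by decide)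
  rw [e1, e2] at h
  exact h

end Summit.Ventures.QEC.Census.A1s_n162_k12_a0a80268
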